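import Summits.Schanuel.Schanuel.Theorems.RoyCriterionNguyenRoySmallValueTranslatesStubDegLowerBound
import Literature.NumberTheory.Transcendental.RoySmallValueEstimatesReversalProofs
import HarnessLib

/-!
# Route `RoyCriterion`, crux `NguyenRoySmallValueTranslates` (stmt-Schanuel-1051), line `Sketch`
# — stub `stub_edgeOneAlgebraic`, helper file 3: aggregation and concentration

Helper lemmas (third file) for the registered stub I (`stub_edgeOneAlgebraic`) of the skeleton of
line `Sketch` for the crux `Summit.Schanuel.Schanuel.Theses.RoyCriterion.NguyenRoySmallValueTranslates`
(Nguyen–Roy 2016, Theorem 1 at the Dirichlet edge when one coordinate of `(ξ, η)` is algebraic).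

* `star_bound` — Proposition 12 in sum form (hypothesis `hLS`) applied to the STAR of pairs
  `(a₁, a)`, `a` in a cluster `C ⊆ conj Z` of points close to one point `q`, `a₁` the closest:
  `∑_{a ∈ C ∖ a₁} −log dist(a, q) ≤ log 2 · d² + 2 d h + #(C ∖ a₁) log 4`;
* `sum_le_of_clusters` — the combinatorial aggregation: closeness values with a pairwise cap `L`,
  at most `dθ` heavy indices and the star bound `B` per cluster have total
  `≤ #S · λ₀ + max + dθ (L + B)`;
* over an abstract `NguyenRoy.EndgameData`: `cap_of_noper` (the pairwise cap of stub B, from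
  `pair_cap` and `τ_neg_ne_of_noper`) and **`conc_of_bounds`** — at a level where
  `d λ₀ + dθ (L + B) < M/2` (`M` = Corollary 16's mass) some point carries half of `M`.

## References

* [NguyenRoy2016] N. A. V. Nguyen, D. Roy, IJNT 12 (2016) 1273–1293 = arXiv:1412.5163,
  Proposition 12, Corollary 16, §6.
-/

-- `Summit.Schanuel.Schanuel.…` is the mandated layout of this single-problem summit (CONVENTIONS §1).
set_option linter.dupNamespace false

noncomputable section

open Filter Finset MvPolynomial
open scoped Classical

namespace Summit.Schanuel.Schanuel.Theorems.NguyenRoySharp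

open Literature.NumberTheory.Transcendental
open Literature.NumberTheory.Transcendental.NguyenRoy

/-! ### The star bound from Proposition 12 in sum form -/

/-- **The star bound.** Assume Proposition 12 in sum form (`hLS`). Let `C ⊆ conj Z` be points at
positive distance from a point `q`, and `a₁ ∈ C` a closest one. Then
`∑_{a ∈ C ∖ a₁} −log dist(a, q) ≤ log 2 · d² + 2 d h + #(C ∖ a₁) · log 4` (`d = #conj Z`,
`h = ht Z`): apply `hLS` to the pairs `(a₁, a)` and use
`dist(a₁, a) ≤ 2(dist(a₁, q) + dist(q, a)) ≤ 4 dist(a, q)`. [cite: NguyenRoy2016, Proposition 12 and §2 (weak triangle inequality)] -/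
theorem star_bound
    (hLS : ∀ (P P' : AlgPt) (A : Finset (PPt × PPt)),
      (∀ x ∈ A, x.1 ∈ P.conj ∧ x.2 ∈ P'.conj ∧ x.1 ≠ x.2) →
      -(Real.log 2 * P.deg * P'.deg + P.deg * P'.ht + P'.deg * P.ht) ≤
        ∑ x ∈ A, Real.log (pdist x.1 x.2))
    (Z : AlgPt) {C : Finset PPt} (hC : C ⊆ Z.conj) (q : PPt) {a₁ : PPt} (ha₁ : a₁ ∈ C)
    (hpos : ∀ a ∈ C, 0 < pdist a q) (hmin : ∀ a ∈ C, pdist a₁ q ≤ pdist a q) :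
    ∑ a ∈ C.erase a₁, -Real.log (pdist a q) ≤
      Real.log 2 * (Z.conj.card : ℝ) ^ 2 + 2 * Z.conj.card * Z.ht + (C.erase a₁).card * Real.log 4 := by
  set A : Finset (PPt × PPt) := (C.erase a₁).image fun a => (a₁, a) with hA
  have hAok : ∀ x ∈ A, x.1 ∈ Z.conj ∧ x.2 ∈ Z.conj ∧ x.1 ≠ x.2 := by
    intro x hx
    obtain ⟨a, ha, rfl⟩ := Finset.mem_image.mp hx
    exact ⟨hC ha₁, hC (Finset.mem_of_mem_erase ha), (Finset.ne_of_mem_erase ha).symm⟩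
  have h1 := hLS Z Z A hAok
  have hinj : Set.InjOn (fun a => (a₁, a)) ((C.erase a₁ : Finset PPt) : Set PPt) :=
    fun a _ b _ h => (Prod.mk.inj h).2
  rw [hA, Finset.sum_image hinj] at h1
  simp only at h1
  -- each term: `log dist(a₁, a) ≤ log 4 + log dist(a, q)`
  have hterm : ∀ a ∈ C.erase a₁, Real.log (pdist a₁ a) ≤ Real.log 4 + Real.log (pdist a q) := by
    intro a ha
    have haC := Finset.mem_of_mem_erase ha
    have hne : a₁ ≠ a := (Finset.ne_of_mem_erase ha).symm
    have hd0 : 0 < pdist a₁ a := pdist_pos_of_ne hne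
    have hq0 := hpos a haC
    have htri : pdist a₁ a ≤ 4 * pdist a q := by
      have := pdist_triangle a₁ q a
      rw [pdist_comm q a] at this
      linarith [hmin a haC]
    rw [← Real.log_mul (by norm_num) hq0.ne']
    exact Real.log_le_log hd0 htri
  have h2 : ∑ a ∈ C.erase a₁, Real.log (pdist a₁ a) ≤
      ∑ a ∈ C.erase a₁, (Real.log 4 + Real.log (pdist a q)) := Finset.sum_le_sum hterm
  rw [Finset.sum_add_distrib, Finset.sum_const, nsmul_eq_mul] at h2
  have h3 : ∑ a ∈ C.erase a₁, -Real.log (pdist a q) = -∑ a ∈ C.erase a₁, Real.log (pdist a q) :=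
    Finset.sum_neg_distrib ..
  rw [h3, AlgPt.card_conj]
  nlinarith [h1, h2]

/-! ### The combinatorial aggregation -/

/-- **Aggregation of closeness under a pairwise cap, few heavy indices and a star bound.** Let
`f` (closeness) and `ι` (index) be functions on a finite set `S` with: `f ≤ Fm` on `S`; a pairwise
cap `min(f a, f b) ≤ L` for `a ≠ b`; at most `dθ` indices among the heavy elements `f ≥ λ₀`; and
within any cluster of equal index, the non-maximal elements have `∑ f ≤ B`. Then
`∑_S f ≤ #S · λ₀ + Fm + dθ (L + B)`: light elements give `≤ #S λ₀`; each heavy cluster gives its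
maximum plus `B`; the cluster maxima are distinct points, so all but one are `≤ L`. [folklore] -/
theorem sum_le_of_clusters {α : Type*} (S : Finset α) (f : α → ℝ) (ι : α → ℤ)
    {lam L B Fm : ℝ} {dθ : ℕ} (hlam : 0 ≤ lam) (hL : 0 ≤ L) (hB : 0 ≤ B) (hFm : 0 ≤ Fm)
    (hmax : ∀ a ∈ S, f a ≤ Fm)
    (hcap : ∀ a ∈ S, ∀ b ∈ S, a ≠ b → min (f a) (f b) ≤ L)
    (hK : ((S.filter fun a => lam ≤ f a).image ι).card ≤ dθ)
    (hstar : ∀ C ⊆ S, ∀ k : ℤ, (∀ a ∈ C, ι a = k) → ∀ a₁ ∈ C, (∀ a ∈ C, f a ≤ f a₁) →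
      ∑ a ∈ C.erase a₁, f a ≤ B) :
    ∑ a ∈ S, f a ≤ S.card * lam + Fm + dθ * (L + B) := by
  classical
  set H := S.filter fun a => lam ≤ f a with hH
  set K := H.image ι with hKdef
  have hHS : H ⊆ S := Finset.filter_subset _ _
  -- light part
  have hsplit := Finset.sum_filter_add_sum_filter_not S (fun a => lam ≤ f a) f
  have hlight : ∑ a ∈ S.filter (fun a => ¬ lam ≤ f a), f a ≤ S.card * lam := by
    calc ∑ a ∈ S.filter (fun a => ¬ lam ≤ f a), f a
        ≤ ∑ a ∈ S.filter (fun a => ¬ lam ≤ f a), lam :=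
          Finset.sum_le_sum fun a ha => (not_le.mp (Finset.mem_filter.mp ha).2).le
      _ = (S.filter (fun a => ¬ lam ≤ f a)).card * lam := by
          rw [Finset.sum_const, nsmul_eq_mul]
      _ ≤ S.card * lam :=
          mul_le_mul_of_nonneg_right (by exact_mod_cast Finset.card_filter_le _ _) hlam
  -- heavy part, fiberwise
  have hfib : ∑ a ∈ H, f a = ∑ k ∈ K, ∑ a ∈ H.filter (fun a => ι a = k), f a :=
    (Finset.sum_fiberwise_of_maps_to (fun a ha => Finset.mem_image_of_mem ι ha) f).symm
  have hKd : (K.card : ℝ) ≤ dθ := by exact_mod_cast hK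
  -- the cluster maxima are distinct points: at most one exceeds `L`
  rcases K.eq_empty_or_nonempty with hKe | hKne
  · have hHe : ∑ a ∈ H, f a ≤ 0 := by
      rw [hfib, hKe, Finset.sum_empty]
    have hdθ : (0 : ℝ) ≤ dθ * (L + B) := by positivity
    linarith
  · obtain ⟨k₁, hk₁⟩ := hKne
    obtain ⟨a, -, -⟩ := Finset.mem_image.mp hk₁
    haveI : Nonempty α := ⟨a⟩
    have hclus : ∀ k ∈ K, ∃ a₁ ∈ H.filter (fun a => ι a = k),
        ∀ a ∈ H.filter (fun a => ι a = k), f a ≤ f a₁ := by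
      intro k hk
      obtain ⟨a, ha, rfl⟩ := Finset.mem_image.mp hk
      exact Finset.exists_max_image _ f ⟨a, Finset.mem_filter.mpr ⟨ha, rfl⟩⟩
    choose! m hm hmmax using hclus
    have hmS : ∀ k ∈ K, m k ∈ S := fun k hk => hHS (Finset.mem_filter.mp (hm k hk)).1
    have hmι : ∀ k ∈ K, ι (m k) = k := fun k hk => (Finset.mem_filter.mp (hm k hk)).2
    have hcl : ∀ k ∈ K, ∑ a ∈ H.filter (fun a => ι a = k), f a ≤ f (m k) + B := by
      intro k hk
      rw [← Finset.add_sum_erase _ _ (hm k hk)]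
      have := hstar (H.filter fun a => ι a = k) ((Finset.filter_subset _ _).trans hHS) k
        (fun a ha => (Finset.mem_filter.mp ha).2) (m k) (hm k hk) (hmmax k hk)
      linarith
    have hheavy : ∑ a ∈ H, f a ≤ ∑ k ∈ K, f (m k) + K.card * B := by
      rw [hfib]
      calc ∑ k ∈ K, ∑ a ∈ H.filter (fun a => ι a = k), f a ≤ ∑ k ∈ K, (f (m k) + B) :=
            Finset.sum_le_sum hcl
        _ = _ := by rw [Finset.sum_add_distrib, Finset.sum_const, nsmul_eq_mul]
    obtain ⟨k₀, hk₀, hconc⟩ := exists_concentrated' K ⟨k₁, hk₁⟩ (fun k => f (m k)) L (by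
      intro k hk k' hk' hne
      refine hcap _ (hmS k hk) _ (hmS k' hk') fun h => hne ?_
      rw [← hmι k hk, ← hmι k' hk', h])
    have hk₀S := hmax _ (hmS k₀ hk₀)
    have h1 : ((K.card : ℝ) - 1) * L ≤ dθ * L := by nlinarith
    have h2 : (K.card : ℝ) * B ≤ dθ * B := by nlinarith
    linarith

/-! ### Over an abstract `EndgameData`: the pairwise cap and the concentration -/

section Abstract

variable {σ β ν : ℝ} (E : EndgameData σ β ν)

/-- **The pairwise cap** (as in stub B): if no point of a class with at least two points has a
non-zero translate in the class, then for an admissible index function `ι` at level `D` and two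
distinct points `a ≠ b` of `Z_D`, the closeness values `f = −(D^β + log dist(·, γ_ι))` satisfy
`min(f a, f b) ≤ c₁₂ d² + 2 d h + 2 c₄ ⌊D^σ⌋ d² + c₁ ⌊D^σ⌋ + log 4`.
[cite: NguyenRoy2016, Proposition 12, Lemma 5, Lemma 11] -/
theorem cap_of_noper
    (hnoper : ∀ Z : E.V, 2 ≤ (E.pts Z).card → ∀ a ∈ E.pts Z, ∀ k : ℤ, k ≠ 0 → E.τ k a ∉ E.pts Z)
    {D : ℕ} {ι : E.Pt → ℤ}
    (hι : ∀ a ∈ E.pts (E.Z D), 0 ≤ ι a ∧ ι a < (⌊(D : ℝ) ^ σ⌋₊ : ℕ))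
    {a b : E.Pt} (ha : a ∈ E.pts (E.Z D)) (hb : b ∈ E.pts (E.Z D)) (hab : a ≠ b) :
    min (-((D : ℝ) ^ β + Real.log (E.dist a (E.γ (ι a)))))
        (-((D : ℝ) ^ β + Real.log (E.dist b (E.γ (ι b))))) ≤
      E.c₁₂ * ((E.pts (E.Z D)).card : ℝ) ^ 2 + 2 * (E.pts (E.Z D)).card * E.ht (E.Z D) +
        2 * E.c₄ * ⌊(D : ℝ) ^ σ⌋₊ * ((E.pts (E.Z D)).card : ℝ) ^ 2 + E.c₁ * ⌊(D : ℝ) ^ σ⌋₊ +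
        Real.log 4 := by
  -- adapted from `stub_degLowerBound` (the `hcap` step)
  obtain ⟨hi0, hiT⟩ := hι a ha
  obtain ⟨hj0, hjT⟩ := hι b hb
  have hne := τ_neg_ne_of_noper E hnoper (E.Z D) ha hb hab (ι a) (ι b)
  have hiT' : ((ι a : ℤ) : ℝ) ≤ ((⌊(D : ℝ) ^ σ⌋₊ : ℕ) : ℝ) := by exact_mod_cast hiT.le
  have hjT' : ((ι b : ℤ) : ℝ) ≤ ((⌊(D : ℝ) ^ σ⌋₊ : ℕ) : ℝ) := by exact_mod_cast hjT.le
  have hc := pair_cap E (E.Z D) ha hb hi0 hj0 hiT' hjT' hne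
  have hDβ : 0 ≤ (D : ℝ) ^ β := by positivity
  calc min (-((D : ℝ) ^ β + Real.log (E.dist a (E.γ (ι a)))))
        (-((D : ℝ) ^ β + Real.log (E.dist b (E.γ (ι b)))))
      ≤ min (-Real.log (E.dist a (E.γ (ι a)))) (-Real.log (E.dist b (E.γ (ι b)))) := by
        apply min_le_min <;> linarith
    _ ≤ _ := hc

/-- **Concentration from the bounds.** At a level `D` with an admissible `ι` and Corollary 16's
bound (`hsum`, mass `M = κ D^{ν−β+σ−2}(2D^β d + D h)`): given the pairwise cap `L`, at most `dθ`
indices among the points with closeness `≥ λ₀`, the star bound `B` for clusters of equal index,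
and `d λ₀ + dθ (L + B) < M/2`, some point `a₀` of `Z_D` carries half of the mass:
`D^β + log dist(a₀, γ_{ι(a₀)}) ≤ −M/2` (otherwise `sum_le_of_clusters` with `Fm = M/2` gives
`M ≤ d λ₀ + M/2 + dθ (L + B)`). [cite: NguyenRoy2016, Corollary 16 and §6] -/
theorem conc_of_bounds {D : ℕ} {ι : E.Pt → ℤ}
    (hsum : ∑ a ∈ E.pts (E.Z D), ((D : ℝ) ^ β + Real.log (E.dist a (E.γ (ι a)))) ≤
      -(E.κ * (D : ℝ) ^ (ν - β + σ - 2) *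
        (2 * (D : ℝ) ^ β * (E.pts (E.Z D)).card + D * E.ht (E.Z D))))
    {lam L B : ℝ} {dθ : ℕ} (hlam : 0 ≤ lam) (hL : 0 ≤ L) (hB : 0 ≤ B)
    (hcap : ∀ a ∈ E.pts (E.Z D), ∀ b ∈ E.pts (E.Z D), a ≠ b →
      min (-((D : ℝ) ^ β + Real.log (E.dist a (E.γ (ι a)))))
        (-((D : ℝ) ^ β + Real.log (E.dist b (E.γ (ι b))))) ≤ L)
    (hK : (((E.pts (E.Z D)).filter fun a =>
      lam ≤ -((D : ℝ) ^ β + Real.log (E.dist a (E.γ (ι a))))).image ι).card ≤ dθ)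
    (hstar : ∀ C ⊆ E.pts (E.Z D), ∀ k : ℤ, (∀ a ∈ C, ι a = k) → ∀ a₁ ∈ C,
      (∀ a ∈ C, -((D : ℝ) ^ β + Real.log (E.dist a (E.γ (ι a)))) ≤
        -((D : ℝ) ^ β + Real.log (E.dist a₁ (E.γ (ι a₁))))) →
      ∑ a ∈ C.erase a₁, -((D : ℝ) ^ β + Real.log (E.dist a (E.γ (ι a)))) ≤ B)
    (hnum : (E.pts (E.Z D)).card * lam + dθ * (L + B) <
      E.κ / 2 * (D : ℝ) ^ (ν - β + σ - 2) *
        (2 * (D : ℝ) ^ β * (E.pts (E.Z D)).card + D * E.ht (E.Z D))) :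
    ∃ a₀ ∈ E.pts (E.Z D),
      (D : ℝ) ^ β + Real.log (E.dist a₀ (E.γ (ι a₀))) ≤
        -(E.κ / 2 * (D : ℝ) ^ (ν - β + σ - 2) *
          (2 * (D : ℝ) ^ β * (E.pts (E.Z D)).card + D * E.ht (E.Z D))) := by
  by_contra hcon
  push Not at hcon
  set S := E.pts (E.Z D) with hS
  set M : ℝ := E.κ * (D : ℝ) ^ (ν - β + σ - 2) *
    (2 * (D : ℝ) ^ β * S.card + D * E.ht (E.Z D)) with hM
  set f : E.Pt → ℝ := fun a => -((D : ℝ) ^ β + Real.log (E.dist a (E.γ (ι a)))) with hf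
  have hM2 : E.κ / 2 * (D : ℝ) ^ (ν - β + σ - 2) *
      (2 * (D : ℝ) ^ β * S.card + D * E.ht (E.Z D)) = M / 2 := by rw [hM]; ring
  rw [hM2] at hcon hnum
  have hM0 : 0 ≤ M := by
    rw [hM]
    have := E.κ_pos
    have := E.ht_nonneg (E.Z D)
    positivity
  have hmax : ∀ a ∈ S, f a ≤ M / 2 := fun a ha => by
    have := hcon a ha
    simp only [hf]
    linarith
  have hagg := sum_le_of_clusters S f ι hlam hL hB (by linarith) hmax hcap hK hstar
  have hsumf : ∑ a ∈ S, f a = -∑ a ∈ S, ((D : ℝ) ^ β + Real.log (E.dist a (E.γ (ι a)))) := by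
    simp only [hf, Finset.sum_neg_distrib]
  have hge : M ≤ ∑ a ∈ S, f a := by rw [hsumf]; linarith
  linarith

end Abstract

end Summit.Schanuel.Schanuel.Theorems.NguyenRoySharp

end
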